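import Literature.Topology.FourManifolds.TrisectionsCentralSurfaceLocal
import Literature.Topology.FourManifolds.WeaklyReducibleTrisections
import Mathlib.Topology.Connected.LocallyPathConnected
import Mathlib.Analysis.Convex.PathConnected
import HarnessLib

/-!
# The central surface of a Gay–Kirby trisection is locally path connected; the complement of a
# non-separating curve is path connected

Topic `Literature/Topology/FourManifolds`; a small proved complement to
`TrisectionsCentralSurfaceLocal.lean` (`IsGKTrisection.exists_linearChart`: near a point of the
central surface `F = ⋂ l, S l` of a trisection with corners, a smooth chart `ψ` of `X` and a
linear automorphism `A` of `ℝ⁴` in which `F` is the plane `{q₀ = q₁ = 0}`, `q = A⁻¹ ψ`) and to the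
vocabulary of `WeaklyReducibleTrisections.lean` (`Trisection.IsCurve`,
`Trisection.IsNonSeparating`: "`Σ ∖ c` is connected").  **Everything here is proved; no
definitions, no named facts.**

* `IsGKTrisection.exists_isPathConnected_subset_nhds`,
  `IsGKTrisection.locallyPathConnectedSpace_iInter` — **the central surface is locally path
  connected**: the chart pieces `(ψ⁻¹ ∘ A)(B ∩ {q₀ = q₁ = 0})` over small balls `B` are path
  connected neighbourhoods (images of convex sets).
* `IsGKTrisection.isPathConnected_iInter_diff` — hence an open connected subset of `F`, in
  particular **the complement `F ∖ δ` of a closed set `δ` with `F ∖ δ` connected, is path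
  connected** (Mathlib's `IsOpen.isConnected_iff_isPathConnected` in the locally path connected
  subspace `F`);
* `IsGKTrisection.isPathConnected_diff_of_isNonSeparating`,
  `IsGKTrisection.exists_path_diff_of_isNonSeparating` — the form used for reducing curves: for a
  curve `δ` on `F` (`Trisection.IsCurve`) with `Trisection.IsNonSeparating S δ`, any two points
  of `F ∖ δ` are joined by a path IN THE SUBSPACE `F` which misses `δ` — the "return path" of the
  dual loop of a non-separating reducing curve
  (`Literature/AlgebraicTopology/FundamentalGroup/CircleValuedCrossingLoop.lean`,
  `TrisectionFunctorGKPi1Obstruction.lean`).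

(Aranda–Zupan 2025, §2 p. 6 and Remark 2.5 use "non-separating" for curves on the central
surface in exactly this sense; that connected open subsets of a surface are path connected is
Willard, *General Topology*, 27.5 with 27.9.)

## References

* D. Gay, R. Kirby, *Trisecting 4-manifolds*, Geom. Topol. 20 (2016), Def. 1 and Fig. 1
  (the sectors are `F × (sector)` near the central surface). [GayKirby2016]
* R. Aranda, A. Zupan, *Manifolds with weakly reducible genus-three trisections are standard*,
  arXiv:2503.04607 (2025), §2 (p. 6), Remark 2.5. [ArandaZupan2025]
* S. Willard, *General Topology*, Addison–Wesley (1970), 27.5, 27.9.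
-/

noncomputable section

open scoped Manifold ContDiff Topology
open Set Function Filter

namespace Literature.Topology.FourManifolds

universe u

variable {X : Type u} [TopologicalSpace X] [T2Space X] [ChartedSpace (EuclideanSpace ℝ (Fin 4)) X]
  {g : ℕ} {k : Fin 3 → ℕ} {S : Fin 3 → Set X}

/-- The stratum plane `{q₀ = q₁ = 0}` of `ℝ⁴` is convex. [folklore] -/
theorem convex_stratumPlane :
    Convex ℝ {q : EuclideanSpace ℝ (Fin 4) | q 0 = 0 ∧ q 1 = 0} := by
  intro q hq q' hq' a b _ _ _
  refine ⟨?_, ?_⟩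
  · show (a • q + b • q') 0 = 0
    simp [hq.1, hq'.1]
  · show (a • q + b • q') 1 = 0
    simp [hq.2, hq'.2]

/-- **Path connected chart neighbourhoods on the central surface.**  For a trisection with
corners `S` of `X` and a point `p` of the central surface `F = ⋂ l, S l`, every neighbourhood of
`p` in the subspace `F` contains a path connected neighbourhood of `p` — the piece of `F` over a
small ball of the linear chart of `IsGKTrisection.exists_linearChart`, in which `F` is the plane
`{q₀ = q₁ = 0}` (the image of a convex set under the inverse chart).
[cite: GayKirby2016, Def. 1 and Fig. 1] -/
theorem IsGKTrisection.exists_isPathConnected_subset_nhds (h : IsGKTrisection X g k S)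
    (p : ↥(⋂ l, S l)) {U : Set ↥(⋂ l, S l)} (hU : U ∈ 𝓝 p) :
    ∃ V ∈ 𝓝 p, IsPathConnected V ∧ V ⊆ U := by
  -- an open set `O'` of `X` about `p` whose trace on `F` lies in `U`
  obtain ⟨t, ht, htU⟩ := (mem_nhds_subtype _ p U).1 hU
  obtain ⟨O', hO't, hO'o, hpO'⟩ := mem_nhds_iff.1 ht
  -- the linear chart at `p`
  obtain ⟨ψ, A, O, -, hOo, hpO, hOψ, -, -, hF, -⟩ := h.exists_linearChart 0 p.2
  set G : Set X := O ∩ O' with hG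
  have hGo : IsOpen G := hOo.inter hO'o
  have hpG : (p : X) ∈ G := ⟨hpO, hpO'⟩
  have hGψ : G ⊆ ψ.source := inter_subset_left.trans hOψ
  -- the chart image of `G` is open and contains `q₀ = A⁻¹ (ψ p)`
  set Φ : X → EuclideanSpace ℝ (Fin 4) := fun y => A.symm (ψ y) with hΦ
  have himg : IsOpen (A.symm '' (ψ '' G)) :=
    A.symm.toHomeomorph.isOpenMap _ ((ψ.isOpen_image_iff_of_subset_source hGψ).2 hGo)
  set q₀ : EuclideanSpace ℝ (Fin 4) := Φ p with hq₀
  have hq₀mem : q₀ ∈ A.symm '' (ψ '' G) := ⟨ψ p, ⟨p, hpG, rfl⟩, rfl⟩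
  obtain ⟨ε, hε, hball⟩ := Metric.isOpen_iff.1 himg q₀ hq₀mem
  -- the plane piece over the ball and its image in `X`
  set Pl : Set (EuclideanSpace ℝ (Fin 4)) := {q | q 0 = 0 ∧ q 1 = 0} with hPl
  have hq₀Pl : q₀ ∈ Pl := by
    have := (hF p hpO).1 p.2
    exact ⟨this.2.1, this.2.2⟩
  have hconv : Convex ℝ (Metric.ball q₀ ε ∩ Pl) := (convex_ball q₀ ε).inter convex_stratumPlane
  have hpcE : IsPathConnected (Metric.ball q₀ ε ∩ Pl) :=
    hconv.isPathConnected ⟨q₀, Metric.mem_ball_self hε, hq₀Pl⟩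
  -- `ψ⁻¹ ∘ A` is continuous on the ball (which maps into `ψ.target`)
  have hAball : ∀ q ∈ Metric.ball q₀ ε, A q ∈ ψ '' G := fun q hq => by
    obtain ⟨z, hz, hzq⟩ := hball hq
    have : A q = z := by rw [← hzq]; simp
    rw [this]; exact hz
  have hcont : ContinuousOn (fun q => ψ.symm (A q)) (Metric.ball q₀ ε ∩ Pl) := by
    refine (ψ.continuousOn_symm.comp A.continuous.continuousOn fun q hq => ?_).mono
      inter_subset_left
    obtain ⟨y, hy, hyq⟩ := hAball q hq
    show A q ∈ ψ.target
    rw [← hyq]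
    exact ψ.map_source (hGψ hy)
  set W : Set X := (fun q => ψ.symm (A q)) '' (Metric.ball q₀ ε ∩ Pl) with hW
  have hWpc : IsPathConnected W := hpcE.image' hcont
  -- `W` is exactly the trace of `F` on `{y ∈ G | Φ y ∈ ball}`
  have hW_sub : W ⊆ (⋂ l, S l) ∩ {y | y ∈ G ∧ Φ y ∈ Metric.ball q₀ ε} := by
    rintro _ ⟨q, ⟨hqb, hqPl⟩, rfl⟩
    obtain ⟨y, hyG, hyq⟩ := hAball q hqb
    have hy_eq : ψ.symm (A q) = y := by rw [← hyq, ψ.left_inv (hGψ hyG)]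
    have hΦy : Φ y = q := by
      show A.symm (ψ y) = q
      rw [hyq]; simp
    show ψ.symm (A q) ∈ _
    rw [hy_eq]
    refine ⟨?_, hyG, by rw [hΦy]; exact hqb⟩
    -- `y ∈ F` by the chart characterisation
    refine (hF y hyG.1).2 ⟨?_, ?_, ?_⟩
    · show A.symm (ψ y) ∈ cornerQuadrant
      rw [show A.symm (ψ y) = q from hΦy]
      exact ⟨le_of_eq hqPl.1.symm, le_of_eq hqPl.2.symm⟩
    · rw [show A.symm (ψ y) = q from hΦy]; exact hqPl.1
    · rw [show A.symm (ψ y) = q from hΦy]; exact hqPl.2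
  have hsub_W : (⋂ l, S l) ∩ {y | y ∈ G ∧ Φ y ∈ Metric.ball q₀ ε} ⊆ W := by
    rintro y ⟨hyF, hyG, hyb⟩
    have hst := (hF y hyG.1).1 hyF
    refine ⟨Φ y, ⟨hyb, hst.2.1, hst.2.2⟩, ?_⟩
    show ψ.symm (A (A.symm (ψ y))) = y
    rw [A.apply_symm_apply, ψ.left_inv (hGψ hyG)]
  have hW_eq : W = (⋂ l, S l) ∩ {y | y ∈ G ∧ Φ y ∈ Metric.ball q₀ ε} :=
    Subset.antisymm hW_sub hsub_W
  -- the neighbourhood `V = F ∩ {y ∈ G | Φ y ∈ ball}` of `p` in `F`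
  set V : Set ↥(⋂ l, S l) := Subtype.val ⁻¹' W with hV
  have hVopen : IsOpen V := by
    have hopen : IsOpen {y | y ∈ G ∧ Φ y ∈ Metric.ball q₀ ε} := by
      have hΦc : ContinuousOn Φ G :=
        (A.symm.continuous.comp_continuousOn ψ.continuousOn).mono hGψ
      exact hΦc.isOpen_inter_preimage hGo Metric.isOpen_ball
    have : V = Subtype.val ⁻¹' {y | y ∈ G ∧ Φ y ∈ Metric.ball q₀ ε} := by
      ext y
      simp only [hV, mem_preimage, hW_eq, mem_inter_iff, mem_setOf_eq]
      exact ⟨fun hy => hy.2, fun hy => ⟨y.2, hy⟩⟩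
    rw [this]
    exact hopen.preimage continuous_subtype_val
  have hpV : p ∈ V := by
    show (p : X) ∈ W
    rw [hW_eq]
    exact ⟨p.2, hpG, Metric.mem_ball_self hε⟩
  refine ⟨V, hVopen.mem_nhds hpV, ?_, fun y hy => ?_⟩
  · exact hWpc.preimage_coe (hW_sub.trans inter_subset_left)
  · -- `V ⊆ U`: points of `V` lie over `G ⊆ O'`
    have hyW : (y : X) ∈ W := hy
    rw [hW_eq] at hyW
    exact htU (hO't hyW.2.1.2)

/-- **The central surface of a trisection with corners is locally path connected** (it is a
topological surface: `IsGKTrisection.exists_linearChart`). [cite: GayKirby2016, Def. 1 and Fig. 1] -/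
theorem IsGKTrisection.locallyPathConnectedSpace_iInter (h : IsGKTrisection X g k S) :
    LocallyPathConnectedSpace ↥(⋂ l, S l) := by
  refine ⟨fun p => ⟨fun U => ⟨fun hU => ?_, fun ⟨V, ⟨hV, _⟩, hVU⟩ => mem_of_superset hV hVU⟩⟩⟩
  obtain ⟨V, hV, hVpc, hVU⟩ := h.exists_isPathConnected_subset_nhds p hU
  exact ⟨V, ⟨hV, hVpc⟩, hVU⟩

/-- **A connected relatively open part of the central surface is path connected**: for a closed
set `δ` of `X` with `F ∖ δ` connected, `F ∖ δ` is path connected (as a subset of `X`).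
[cite: GayKirby2016, Def. 1 and Fig. 1] -/
theorem IsGKTrisection.isPathConnected_iInter_diff (h : IsGKTrisection X g k S) {δ : Set X}
    (hδ : IsClosed δ) (hc : IsConnected ((⋂ l, S l) \ δ)) : IsPathConnected ((⋂ l, S l) \ δ) := by
  haveI := h.locallyPathConnectedSpace_iInter
  -- the trace `A = F ∖ δ` on the subspace `F` is open and connected, hence path connected
  set A : Set ↥(⋂ l, S l) := Subtype.val ⁻¹' δᶜ with hA
  have hAo : IsOpen A := hδ.isOpen_compl.preimage continuous_subtype_val
  have himage : Subtype.val '' A = (⋂ l, S l) \ δ := by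
    ext y
    simp only [hA, mem_image, mem_preimage, mem_compl_iff, Set.mem_sdiff]
    constructor
    · rintro ⟨z, hz, rfl⟩; exact ⟨z.2, hz⟩
    · rintro ⟨hyF, hyδ⟩; exact ⟨⟨y, hyF⟩, hyδ, rfl⟩
  have hAc : IsConnected A := by
    refine ⟨?_, ?_⟩
    · obtain ⟨y, hyF, hyδ⟩ := hc.nonempty
      exact ⟨⟨y, hyF⟩, hyδ⟩
    · rw [← Topology.IsInducing.subtypeVal.isPreconnected_image, himage]
      exact hc.isPreconnected
  have hApc : IsPathConnected A := (hAo.isConnected_iff_isPathConnected).1 hAc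
  rw [← himage]
  exact hApc.image continuous_subtype_val

/-- A curve on the central surface is a closed subset of `X` (the image of a circle under a
continuous map into a Hausdorff space). [cite: ArandaZupan2025, §2 (p. 3)] -/
theorem Trisection.IsCurve.isClosed {δ : Set X} (hc : Trisection.IsCurve S δ) : IsClosed δ := by
  obtain ⟨-, γ, hγ, hrange⟩ := hc
  rw [← hrange]
  exact (isCompact_range hγ.contMDiff.continuous).isClosed

/-- **The complement of a non-separating curve of the central surface is path connected.**
[cite: ArandaZupan2025, §2 (p. 6) and Remark 2.5] -/
theorem IsGKTrisection.isPathConnected_diff_of_isNonSeparating (h : IsGKTrisection X g k S)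
    {δ : Set X} (hc : Trisection.IsCurve S δ) (hns : Trisection.IsNonSeparating S δ) :
    IsPathConnected (Trisection.centralSurfaceSet S \ δ) :=
  h.isPathConnected_iInter_diff hc.isClosed hns

/-- **The return path of the dual loop.**  For a non-separating curve `δ` of the central surface
and two points `a, b ∈ F ∖ δ` there is a path from `a` to `b` in the SUBSPACE `F = ⋂ l, S l`
all of whose points lie off `δ`. [cite: ArandaZupan2025, §2 (p. 6) and Remark 2.5] -/
theorem IsGKTrisection.exists_path_diff_of_isNonSeparating (h : IsGKTrisection X g k S)
    {δ : Set X} (hc : Trisection.IsCurve S δ) (hns : Trisection.IsNonSeparating S δ)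
    {a b : X} (ha : a ∈ (⋂ l, S l) \ δ) (hb : b ∈ (⋂ l, S l) \ δ) :
    ∃ β : Path (⟨a, ha.1⟩ : ↥(⋂ l, S l)) ⟨b, hb.1⟩, ∀ s, (β s : X) ∉ δ := by
  have hpc := h.isPathConnected_diff_of_isNonSeparating hc hns
  have hj : JoinedIn ((⋂ l, S l) \ δ) a b := hpc.joinedIn a ha b hb
  -- a path in the subspace `F ∖ δ`, pushed into the subspace `F`
  set γ := hj.somePath with hγ
  have hγmem : ∀ s, γ s ∈ (⋂ l, S l) \ δ := hj.somePath_mem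
  refine ⟨⟨⟨fun s => ⟨γ s, (hγmem s).1⟩, ?_⟩, ?_, ?_⟩, fun s => (hγmem s).2⟩
  · exact γ.continuous.subtype_mk _
  · exact Subtype.ext (by simp)
  · exact Subtype.ext (by simp)

end Literature.Topology.FourManifolds

end
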